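import Summits.SmoothPoincare4.SmoothPoincare4.Theses.WeakReductionDescent
import Literature.Topology.FourManifolds.SphereTrisectionsSectors
import Literature.Topology.FourManifolds.TrisectionFunctorGKNaturality

/-!
# `DependentTripleAtThree` — negative side (refuter birth vet): a refutation is an exotic 4-sphere; modulo X_F the crux is the (3;1,1,1) frontier; the trisection hypothesis is load-bearing

Negative lane of crux `WeakReductionDescent.DependentTripleAtThree` (item stmt-SmoothPoincare4-17999,
route `route-SmoothPoincare4-WeakReductionDescent` rev 2, piece X₁ of the rung split of K1), seat
refuter-rattack-stmt-SmoothPoincare4-17999-0, 2026-08-17.  Companion of the crux workfile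
`Cruxes/DependentTripleAtThree/BirthAttack.lean` (which also carries the positive-shaped shield
`SmoothPoincare4 → DependentTripleAtThree` and the paper findings); here only statements whose
conclusion does not assert a route item.

* `not_minimal_three_of_diffeomorph` — an `M ≅ S⁴` has GK's genus-`0` trisection
  (`sphere_genusZero_gkTrisection_holds`, transported by `IsGKTrisection.image_diffeomorph'`, both
  PROVED), so the crux's minimality hypothesis `∀ g' k' T', IsGKTrisection M g' k' T' → 3 ≤ g'`
  fails there.
* `not_smoothPoincare4_of_not_dependentTripleAtThree`, `exotic_of_not_dependentTripleAtThree` —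
  KILL CRITERION: a refutation of the crux is a smooth homotopy 4-sphere of trisection genus
  exactly `3` whose minimal genus-`3` GK-trisection admits no dependent triple, admitting no
  diffeomorphism to `S⁴`; in particular `¬ SmoothPoincare4`.  The crux is SPC4-shielded.
* `dependentTripleAtThree_iff_noMinimalGenusThree` — modulo the route's own support
  `DependentTripleGenusThreeStandard` (X_F, Aranda–Zupan 2025 Thm 1.4 / Cor 1.5 for homotopy
  spheres) the crux is EQUIVALENT to "no smooth homotopy 4-sphere has a minimal GK-trisection of
  genus `3`" — the first open type (3;1,1,1) of
  `Literature.Barriers.SmoothPoincare4.LowGenusTrisectionBarrier`: the dependent-triple phrasing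
  is a certificate format for that frontier (strictly wider than a weak reduction, AZ25 §7 case
  (3)), as the planner's `why_might_fail` declares.
* `dependentTriple_false_without_trisection` — dropping the hypothesis `IsGKTrisection M 3 k T`
  (and minimality) while keeping the bare binders and `e : M ≃ₕ S⁴` gives a FALSE statement:
  the round `S⁴` with empty sectors (empty central surface, but a curve is the range of a map
  from the nonempty circle).  Any proof must use the trisection hypothesis.
-/

open scoped Manifold ContDiff Topology ContinuousMap
open Set

-- the registered namespace `Summit.SmoothPoincare4.SmoothPoincare4.Theorems` repeats a component
set_option linter.dupNamespace false

namespace Summit.SmoothPoincare4.SmoothPoincare4.Theorems.DependentTripleAtThree.Negative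

open Literature.Topology.FourManifolds
open Summit.SmoothPoincare4.SmoothPoincare4.Theses.WeakReductionDescent

variable {M : Type} [TopologicalSpace M] [ChartedSpace (EuclideanSpace ℝ (Fin 4)) M]
  [IsManifold (𝓡 4) ∞ M]

/-- A diffeomorphism to the round sphere pulls GK's genus-`0` trisection of `S⁴` back to a
genus-`0` GK-trisection of `M`. [folklore] -/
theorem exists_isGKTrisection_genus_zero_of_diffeomorph
    (Φ : M ≃ₘ⟮𝓡 4, 𝓡 4⟯ (Metric.sphere (0 : EuclideanSpace ℝ (Fin 5)) 1)) :
    ∃ T : Fin 3 → Set M, IsGKTrisection M 0 (fun _ => 0) T := by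
  obtain ⟨S₀, hS₀⟩ := sphere_genusZero_gkTrisection_holds
  exact ⟨fun i => Φ.symm '' S₀ i, hS₀.isGKTrisection.image_diffeomorph' Φ.symm⟩

/-- If `M ≅ S⁴`, genus `3` is not the minimal trisection genus of `M` (the crux's minimality
hypothesis fails). [folklore] -/
theorem not_minimal_three_of_diffeomorph
    (Φ : M ≃ₘ⟮𝓡 4, 𝓡 4⟯ (Metric.sphere (0 : EuclideanSpace ℝ (Fin 5)) 1))
    (hmin : ∀ (g' : ℕ) (k' : Fin 3 → ℕ) (T' : Fin 3 → Set M), IsGKTrisection M g' k' T' → 3 ≤ g') :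
    False := by
  obtain ⟨T₀, hT₀⟩ := exists_isGKTrisection_genus_zero_of_diffeomorph Φ
  have := hmin 0 (fun _ => 0) T₀ hT₀
  omega

/-- **Kill criterion, contrapositive form.** A refutation of the crux refutes the summit: under
`SmoothPoincare4` every smooth homotopy 4-sphere is `≅ S⁴`, so none has minimal trisection genus
`3` and the crux holds vacuously. [folklore] -/
theorem not_smoothPoincare4_of_not_dependentTripleAtThree (h : ¬ DependentTripleAtThree) :
    ¬ _root_.SmoothPoincare4 := by
  intro hS
  apply h
  intro M _ _ _ _ _ e k T _hT hmin
  obtain ⟨Φ⟩ := hS M ‹_› ‹_› e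
  exact (not_minimal_three_of_diffeomorph Φ hmin).elim

/-- **What a kill would be**: a smooth homotopy 4-sphere `M` with a genus-`3` GK-trisection `T`
that is of minimal genus for `M` and admits NO dependent triple (the crux's `let`-bound
conclusion negated, verbatim), and with no diffeomorphism to the round `S⁴` — an exotic
4-sphere of trisection genus `3`. [folklore] -/
theorem exotic_of_not_dependentTripleAtThree (h : ¬ DependentTripleAtThree) :
    ∃ (M : Type) (_ : TopologicalSpace M) (_ : T2Space M) (_ : SecondCountableTopology M)
      (_ : ChartedSpace (EuclideanSpace ℝ (Fin 4)) M) (_ : IsManifold (𝓡 4) ∞ M),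
      Nonempty (M ≃ₕ (Metric.sphere (0 : EuclideanSpace ℝ (Fin 5)) 1)) ∧
      (∃ (k : Fin 3 → ℕ) (T : Fin 3 → Set M), IsGKTrisection M 3 k T ∧
        (∀ (g' : ℕ) (k' : Fin 3 → ℕ) (T' : Fin 3 → Set M), IsGKTrisection M g' k' T' → 3 ≤ g') ∧
        ¬ (let F : Set M := ⋂ l, T l; let H : Fin 3 → Set M := fun p => ⋂ (l : Fin 3) (_ : l ≠ p), T l; let IsCurve : Set M → Prop := fun c => c ⊆ F ∧ ∃ γ : (Metric.sphere (0 : EuclideanSpace ℝ (Fin 2)) 1) → M, Manifold.IsSmoothEmbedding (𝓡 1) (𝓡 4) ((⊤ : ℕ∞) : WithTop ℕ∞) γ ∧ Set.range γ = c; let BoundsDisc : Set M → Set M → Prop := fun A c => ∃ d : (Metric.closedBall (0 : EuclideanSpace ℝ (Fin 2)) 1) → M, Manifold.IsSmoothEmbedding (𝓡∂ 2) (𝓡 4) ((⊤ : ℕ∞) : WithTop ℕ∞) d ∧ Set.range d ⊆ A ∧ d '' ((𝓡∂ 2).boundary (Metric.closedBall (0 : EuclideanSpace ℝ (Fin 2))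 1)) = c ∧ Set.range d ∩ F = c; let NonSep : Set M → Prop := fun c => IsConnected (F \ c); let DependentTriple : Prop := ∃ (a b c : Set M), IsCurve a ∧ IsCurve b ∧ IsCurve c ∧ Disjoint a b ∧ Disjoint b c ∧ Disjoint a c ∧ NonSep a ∧ NonSep b ∧ NonSep c ∧ BoundsDisc (H 0) a ∧ BoundsDisc (H 1) b ∧ BoundsDisc (H 2) c ∧ ¬ IsPreconnected (F \ (a ∪ b ∪ c)); DependentTriple)) ∧
      IsEmpty (M ≃ₘ⟮𝓡 4, 𝓡 4⟯ (Metric.sphere (0 : EuclideanSpace ℝ (Fin 5)) 1)) := by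
  unfold DependentTripleAtThree at h
  push Not at h
  obtain ⟨M, _, _, _, _, _, e, k, T, hT, hmin, hdt⟩ := h
  exact ⟨M, ‹_›, ‹_›, ‹_›, ‹_›, ‹_›, ⟨e⟩, ⟨k, T, hT, hmin, hdt⟩,
    ⟨fun Φ => not_minimal_three_of_diffeomorph Φ hmin⟩⟩

/-- **Crux ≡ (3;1,1,1) frontier modulo X_F.** Modulo the route's support
`DependentTripleGenusThreeStandard` (Aranda–Zupan 2025 Thm 1.4 / Cor 1.5 for homotopy spheres),
the crux is EQUIVALENT to "no smooth homotopy 4-sphere has a GK-trisection of genus `3` that is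
of minimal genus": `→` — a dependent triple makes `M ≅ S⁴` (X_F), contradicting minimality;
`←` — vacuity. [folklore] -/
theorem dependentTripleAtThree_iff_noMinimalGenusThree (hF : DependentTripleGenusThreeStandard) :
    DependentTripleAtThree ↔
      ∀ (M : Type) [TopologicalSpace M] [T2Space M] [SecondCountableTopology M]
        [ChartedSpace (EuclideanSpace ℝ (Fin 4)) M] [IsManifold (𝓡 4) ∞ M],
        (M ≃ₕ (Metric.sphere (0 : EuclideanSpace ℝ (Fin 5)) 1)) → ∀ (k : Fin 3 → ℕ) (T : Fin 3 → Set M),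
          IsGKTrisection M 3 k T →
            ¬ ∀ (g' : ℕ) (k' : Fin 3 → ℕ) (T' : Fin 3 → Set M), IsGKTrisection M g' k' T' → 3 ≤ g' := by
  constructor
  · intro h1 M _ _ _ _ _ e k T hT hmin
    obtain ⟨Φ⟩ := hF M e k T hT (h1 M e k T hT hmin)
    exact not_minimal_three_of_diffeomorph Φ hmin
  · intro h M _ _ _ _ _ e k T hT hmin
    exact absurd hmin (h M e k T hT)

/-- **`_false_without_` the trisection hypothesis.** The crux with `IsGKTrisection M 3 k T` and
minimality deleted (bare binders, `e : M ≃ₕ S⁴`, the `let`-bound conclusion verbatim) is FALSE: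
witness the round `S⁴` with empty sectors — the central surface is empty while a curve is the
range of a map from the nonempty circle. [folklore] -/
theorem dependentTriple_false_without_trisection :
    ¬ ∀ (M : Type) [TopologicalSpace M] [T2Space M] [SecondCountableTopology M]
        [ChartedSpace (EuclideanSpace ℝ (Fin 4)) M] [IsManifold (𝓡 4) ∞ M],
        (M ≃ₕ (Metric.sphere (0 : EuclideanSpace ℝ (Fin 5)) 1)) → ∀ (_k : Fin 3 → ℕ) (T : Fin 3 → Set M),
        (let F : Set M := ⋂ l, T l; let H : Fin 3 → Set M := fun p => ⋂ (l : Fin 3) (_ : l ≠ p), T l; let IsCurve : Set M → Prop := fun c => c ⊆ F ∧ ∃ γ : (Metric.sphere (0 : EuclideanSpace ℝ (Fin 2)) 1) → M, Manifold.IsSmoothEmbedding (𝓡 1) (𝓡 4) ((⊤ : ℕ∞) : WithTop ℕ∞) γ ∧ Set.range γ = c; let BoundsDisc : Set M → Set M → Prop := fun A c => ∃ d : (Metric.closedBall (0 : EuclideanSpace ℝ (Fin 2)) 1) → M, Manifold.IsSmoothEmbedding (𝓡∂ 2) (𝓡 4) ((⊤ : ℕ∞) : WithTop ℕ∞) d ∧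 Set.range d ⊆ A ∧ d '' ((𝓡∂ 2).boundary (Metric.closedBall (0 : EuclideanSpace ℝ (Fin 2)) 1)) = c ∧ Set.range d ∩ F = c; let NonSep : Set M → Prop := fun c => IsConnected (F \ c); let DependentTriple : Prop := ∃ (a b c : Set M), IsCurve a ∧ IsCurve b ∧ IsCurve c ∧ Disjoint a b ∧ Disjoint b c ∧ Disjoint a c ∧ NonSep a ∧ NonSep b ∧ NonSep c ∧ BoundsDisc (H 0) a ∧ BoundsDisc (H 1) b ∧ BoundsDisc (H 2) c ∧ ¬ IsPreconnected (F \ (a ∪ b ∪ c)); DependentTriple) := by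
  intro h
  have h0 := h (Metric.sphere (0 : EuclideanSpace ℝ (Fin 5)) 1)
    (ContinuousMap.HomotopyEquiv.refl _) (fun _ => 1) (fun _ => ∅)
  obtain ⟨a, b, c, ⟨haF, γ, -, hγ⟩, -⟩ := h0
  have hF : (⋂ l : Fin 3, (fun _ : Fin 3 => (∅ : Set (Metric.sphere (0 : EuclideanSpace ℝ (Fin 5)) 1))) l) = ∅ := by
    simpa using (iInter_const (ι := Fin 3) (s := (∅ : Set (Metric.sphere (0 : EuclideanSpace ℝ (Fin 5)) 1))))
  have ha : a = ∅ := subset_empty_iff.mp (hF ▸ haF)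
  obtain ⟨x, hx⟩ := (NormedSpace.sphere_nonempty (x := (0 : EuclideanSpace ℝ (Fin 2)))
    (r := 1)).mpr zero_le_one
  have : γ ⟨x, hx⟩ ∈ a := hγ ▸ mem_range_self _
  simp [ha] at this

end Summit.SmoothPoincare4.SmoothPoincare4.Theorems.DependentTripleAtThree.Negative
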